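import Summits.AnomalousDissipation.AnomalousDissipation.Theses.EnsembleRigidity
import Summits.AnomalousDissipation.AnomalousDissipation.Theorems.EnsembleRigidityDefs
import Summits.AnomalousDissipation.AnomalousDissipation.Theorems.GPStatisticalRigidity.Negative.DiracShadow
import HarnessLib

/-!
# Line `static-dynamic` — crux `EnsembleRigidity.GPStatisticalRigidity` (stmt-AnomalousDissipation-15508)
# ALTERNATIVE skeleton (crux-strategist, 2026-08-17): the STATIC / DYNAMIC split of statistical Lamb rigidity

Registered lines of this crux cut it by ENERGY LEVEL and DUALITY (`Lines/Sketch.lean`, `Lines/birth.lean`: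
vacuous regime + weak duality + certificate family C2) or, in the sibling route `TameRoughRigidity`, by
ENSTROPHY REGIME (N no exact Euler statistics / K tame closure / R conditional Onsager calibration). This line
cuts it along the ENEMY TAXONOMY instead — single FIELDS versus genuinely STATISTICAL measures:

* a probability measure `μ` with small cylindrical forced-Euler defect `R` is **static-dominated at scale `2R`** when
  at least half of its mass sits on fields that are themselves `2R`-near-dodgers of `f_GP` (single-field `H⁻¹`
  residual `sup_w |⟨f_GP − B(v,v), w⟩| / ‖∇w‖₂ ≤ 2R`), and **dynamic-dominated** otherwise (the ensemble defect is
  small only by cancellation BETWEEN fields — a probability current, i.e. dynamics);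
* `stub_singleFieldRigidity` (SF) — SINGLE-FIELD LAMB RIGIDITY OF `f_GP` AT EVERY LEVEL (no work sign):
  `∀ E ∃ c δ₀ > 0, LambRigidAt f_GP E c δ₀` — the Dirac shadow of the crux (NECESSARY: landed
  `Negative.DiracShadow.lambRigid_of_crux`), clause for clause the body of `VirtualDissipation.LambRigidGP`
  (stmt-15150) at every level; the whole single-field enemy class (exact dodgers, near-dodger sequences, rough
  single-field sequences — `Negative.…not_gpStatisticalRigidity_of_lambSoft`) lives here and ONLY here;
* `stub_quasiStaticReduction` (QS) — ANTI-DILUTION (provable now, size L): SF ⇒ the crux's conclusion for every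
  static-dominated admissible `μ`, with `c = c'(4E₊+4)/4`, `δ₀ = δ'(4E₊+4)/4`: energy-Chebyshev leaves mass
  `≥ 1/4` on `{‖v‖² ≤ 4E₊+4} ∩ {2R-near-dodgers}`; there SF (applied to Galerkin truncations `P_K v → v` in `H¹`,
  residual error `≲ ‖v − P_K v‖_{H¹}‖v‖_{H¹} → 0` uniformly on `‖∇w‖₂ ≤ 1` by `H¹ ⊂ L⁴`) gives
  `‖∇v‖ ≥ c'/(2R)`, hence `G ≥ ¼ (c'/2R)²`, i.e. `R√G ≥ c'/4`. Mixing near-dodgers never beats single-field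
  rigidity. NOTE: the defect clause is NOT needed on this branch;
* `stub_dynamicBranch` (DYN) — THE OPEN CONTENT: the crux's conclusion block (all hypotheses of the crux kept
  verbatim, including the cylindrical defect clause and the shell-work clause) for DYNAMIC-dominated `μ`:
  `μ{v : v is not a 2R-near-dodger} > 1/2`. Its enemies are orbit measures of tame recurrent forced-Euler
  dynamics of `f_GP`, thermalised / random-phase ensembles and rough dynamic statistics — none of which is a
  single-field object; its tools are dynamical (Ambrosio–Trevisan superposition = path lift of `μ` to a stationary
  process solving forced Euler with effective dissipation `≤ R√G`, arXiv:1402.4788 Thm 7.1; finite-mode interval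
  rigidity of Kishimoto–Yoneda type, arXiv:2110.08039; recurrence / local energy balance along paths);
* `staticDynamicBlock_of_pieces : SF-sig → QS-sig → DYN-sig → ∀ f = f_GP ∀ E, (the crux's conclusion block)` —
  SORRY-FREE: constants `min`, case split on `μ(bad set) ≤ 1/2`;
* `GPStatisticalRigidity_of : GPStatisticalRigidity` — the crux BY NAME from the three stubs.

Orthogonality with the regime split: SF ∧ DYN is "fields / statistics", N ∧ K ∧ R is "tame / rough"; the two
cuts cross (SF's rough flank = VirtualDissipation's sweeping rigidity K3; DYN's tame flank = "no exact Euler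
statistics of `f_GP` with genuine dynamics", N minus Diracs, reachable by K-type compactness).

## Disproof used (`Cruxes/GPStatisticalRigidity/Disproof.lean` v4 + `Negative/*`, read 2026-08-17)

* `gpStatisticalRigidity_false_without_prob`: the mass normalisation is used in QS (Chebyshev with total mass 1)
  and kept in DYN. `gpStatisticalRigidity_false_without_defect`: the Dirac mass AT REST has single-field residual
  `‖f_GP‖_{Ḣ⁻¹} ≈ 0.195 > 2R` (for `δ₀ < 0.09`), so it is DYNAMIC-dominated and meets DYN, which keeps the defect
  clause verbatim — consistent; QS needs no defect clause because its hypothesis already encodes near-dodging.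
* `not_gpStatisticalRigidity_of_exactEulerStatistics` / `…_of_eulerSSS` (R = 0 kill switch): an exact statistics
  supported (≥ half) on exact dodgers is killed by SF (`c' ≤ 0`), any other exact statistics must be excluded by
  DYN — the kill class is split, not assumed away. `not_gpStatisticalRigidity_of_lambSoft`: near-dodger sequences
  refute SF directly (SF is necessary), consistent.
* `Negative/DiracShadow`: SF is literally `∀ E, ∃ c δ₀, LambRigidAt gpForce E c δ₀`, the shape `lambRigid_of_crux`
  proves necessary. §6 level-uniform strengthening NOT claimed (constants level-wise).
* No `-- Targets` entry of the disproof file hits SF, QS or DYN; no landed Negative lemma refutes an instance.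
-/

set_option linter.dupNamespace false

noncomputable section

namespace Summit.AnomalousDissipation.AnomalousDissipation.Cruxes.GPStatisticalRigidity.StaticDynamic

open MeasureTheory Filter Topology UnitAddTorus
open scoped InnerProductSpace RealInnerProductSpace ENNReal NNReal
open Literature.Analysis.FunctionSpaces Literature.Analysis.FluidPDE
open Summit.AnomalousDissipation.AnomalousDissipation.Theorems.EnsembleRigidity
open Summit.AnomalousDissipation.AnomalousDissipation.Theorems.GPStatisticalRigidity.Negative (LambRigidAt)

/-- Local notation: real vector fields on `T³`. -/
local notation "Vec3" => (UnitAddTorus (Fin 3)) → (EuclideanSpace ℝ (Fin 3))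
/-- Local notation: `L²(T³; ℝ³)`. -/
local notation "L2" => (Lp (EuclideanSpace ℝ (Fin 3)) 2 (volume : Measure (UnitAddTorus (Fin 3))))
/-- Local notation: the energy space `H`. -/
local notation "H3" => (Torus.energySpace (Fin 3))

/-! ## Stubs -/

/-- **SF `stub_singleFieldRigidity`** — SINGLE-FIELD LAMB RIGIDITY OF `f_GP` AT EVERY ENERGY LEVEL (no work
sign): for every `E` there are `c, δ₀ > 0` such that every smooth divergence-free mean-zero `U` with
`∫|U|² ≤ E` and `H⁻¹`-Euler residual `sup_w |∫⟨(U·∇)U − f_GP, w⟩| / ‖∇w‖₂ ≤ R ≤ δ₀` pays `c ≤ R‖∇U‖₂`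
(`LambRigidAt`, `Negative/DiracShadow.lean`). NECESSARY for the crux (`lambRigid_of_crux`); the body of
`VirtualDissipation.LambRigidGP` (stmt-15150) at every level instead of one level `≥ 2`. Open (the static enemy
class: exact dodgers — none on ≤ 2 helical shells by hand, none found on multi-shell supports, Disproof §7/§8c;
near-dodger sequences; rough single-field sequences = VirtualDissipation's sweeping-rigidity crux K3).
[arXiv:1404.1098, arXiv:2110.08039, Summits/AnomalousDissipation/AnomalousDissipation/Theses/VirtualDissipation.lean] -/
theorem stub_singleFieldRigidity (f : Vec3) (hf : f = gpForce) (E : ℝ) :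
    ∃ c δ₀ : ℝ, 0 < c ∧ 0 < δ₀ ∧ LambRigidAt f E c δ₀ := by
  sorry

/-- **QS `stub_quasiStaticReduction`** — ANTI-DILUTION (provable now, size L). Single-field rigidity at all
levels implies the crux's conclusion on every STATIC-dominated admissible measure: if at least half of the mass of
`μ` sits on `2R`-near-dodgers of `f` (fields `v ∈ H` with `|⟨f − B(v,v), w⟩| ≤ 2R‖∇w‖₂` for all `w ∈ 𝒱`, all
derivatives on `w`), then `c ≤ R√G` with `c = c'/4`, `δ₀ = δ'/4` taken from SF at level `4E₊ + 4`. Proof: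
energy-Chebyshev (`μ{‖v‖² > 4E₊+4} ≤ 1/4`) leaves mass `≥ 1/4` on bounded-energy near-dodgers; `μ`-a.e. `v` has
finite enstrophy, its Galerkin truncations `P_K v` are smooth solenoidal mean-zero with `∫|P_K v|² ≤ ‖v‖²` and
residual `≤ 2R + C‖v − P_K v‖_{H¹}‖v‖_{H¹}` (`H¹ ⊂ L⁴` on `T³`), so SF gives `c' ≤ 2R‖∇v‖₂` in the limit; hence
`G ≥ ¼(c'/2R)²`. The cylindrical defect clause is not needed on this branch. [FoiasManleyRosaTemam2001] -/
theorem stub_quasiStaticReduction (f : Vec3) (hf : f = gpForce)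
    (hSF : ∀ E : ℝ, ∃ c δ₀ : ℝ, 0 < c ∧ 0 < δ₀ ∧ LambRigidAt f E c δ₀) (E : ℝ) :
    ∃ c δ₀ : ℝ, 0 < c ∧ 0 < δ₀ ∧ ∀ μ : Measure H3, IsProbabilityMeasure μ →
      Integrable (fun v : H3 => ‖v‖ ^ 2) μ → Torus.ensembleEnergy μ ≤ E → Torus.ensembleEnstrophy μ < ⊤ →
      ∀ R : ℝ, 0 ≤ R → R ≤ δ₀ →
        μ {v : H3 | ¬ (∀ w : Vec3, Torus.IsSmooth w → Torus.IsDivFree w → Torus.HasZeroMean w →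
            |Torus.nsGeneratorPairing 0 f v w| ≤ 2 * R * Real.sqrt (Torus.gradNormSq w))} ≤ 1 / 2 →
        c ≤ R * Real.sqrt (Torus.ensembleEnstrophy μ).toReal := by
  sorry

/-- **DYN `stub_dynamicBranch`** — THE OPEN CONTENT: statistical Lamb rigidity of `f_GP` on DYNAMIC-dominated
measures. For every `E` there are `c, δ₀ > 0` such that every Borel probability measure on `H` with integrable
energy `≤ E`, finite mean enstrophy `G`, non-negative shell work, cylindrical forced-Euler defect `≤ R ≤ δ₀`, and
MORE THAN HALF of its mass on fields that are NOT `2R`-near-dodgers of `f_GP`, pays `c ≤ R√G`. The defect of such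
a `μ` is small only by cancellation between fields (a probability current): its enemies are orbit measures of tame
recurrent (time-periodic, quasi-periodic) forced-Euler flows of `f_GP`, thermalised / random-phase ensembles and
rough dynamic statistics; at `R = 0` it says "every exact Euler statistics of `f_GP` not carried by exact dodgers
is impossible" (N minus Diracs). Tools: Ambrosio–Trevisan superposition (path lift to a stationary process solving
forced Euler + effective dissipation `≤ R√G`), finite-mode interval rigidity (Kishimoto–Yoneda), recurrence and
local energy balance along paths. Size: open problem.
[arXiv:1402.4788, arXiv:2110.08039, arXiv:1404.1098, FoiasManleyRosaTemam2001] -/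
theorem stub_dynamicBranch (f : Vec3) (hf : f = gpForce) (E : ℝ) :
    ∃ c δ₀ : ℝ, 0 < c ∧ 0 < δ₀ ∧ ∀ μ : Measure H3, IsProbabilityMeasure μ →
      Integrable (fun v : H3 => ‖v‖ ^ 2) μ → Torus.ensembleEnergy μ ≤ E → Torus.ensembleEnstrophy μ < ⊤ →
      (∀ e₁ e₂ : ℝ≥0∞, e₁ < e₂ →
        0 ≤ ∫ v in {v : H3 | e₁ ≤ ‖v‖ₑ ^ 2 ∧ ‖v‖ₑ ^ 2 < e₂}, Torus.pairing (v : L2) f ∂μ) →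
      ∀ R : ℝ, 0 ≤ R → R ≤ δ₀ →
        (∀ Φ : Torus.CylindricalTest (Fin 3),
          Integrable (fun v : H3 => Torus.nsGeneratorPairing 0 f v (Φ.grad v)) μ ∧
            |∫ v, Torus.nsGeneratorPairing 0 f v (Φ.grad v) ∂μ| ≤
              R * Real.sqrt (∫ v, Torus.gradNormSq (Φ.grad v) ∂μ)) →
        1 / 2 < μ {v : H3 | ¬ (∀ w : Vec3, Torus.IsSmooth w → Torus.IsDivFree w → Torus.HasZeroMean w →
            |Torus.nsGeneratorPairing 0 f v w| ≤ 2 * R * Real.sqrt (Torus.gradNormSq w))} →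
        c ≤ R * Real.sqrt (Torus.ensembleEnstrophy μ).toReal := by
  sorry

/-! ## Composition -/

/-- **The crux's conclusion block at every level, from the three pieces** (SORRY-FREE; the implication content
of the skeleton). Constants `c = min c_QS c_DYN`, `δ₀ = min δ_QS δ_DYN`; split on whether the `2R`-bad set
(fields that are not `2R`-near-dodgers) has mass `≤ 1/2` (QS, fed by SF) or `> 1/2` (DYN). -/
theorem staticDynamicBlock_of_pieces
    (hSF : ∀ (f : Vec3), f = gpForce → ∀ E : ℝ, ∃ c δ₀ : ℝ, 0 < c ∧ 0 < δ₀ ∧ LambRigidAt f E c δ₀)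
    (hQS : ∀ (f : Vec3), f = gpForce →
      (∀ E : ℝ, ∃ c δ₀ : ℝ, 0 < c ∧ 0 < δ₀ ∧ LambRigidAt f E c δ₀) → ∀ E : ℝ,
      ∃ c δ₀ : ℝ, 0 < c ∧ 0 < δ₀ ∧ ∀ μ : Measure H3, IsProbabilityMeasure μ →
        Integrable (fun v : H3 => ‖v‖ ^ 2) μ → Torus.ensembleEnergy μ ≤ E → Torus.ensembleEnstrophy μ < ⊤ →
        ∀ R : ℝ, 0 ≤ R → R ≤ δ₀ →
          μ {v : H3 | ¬ (∀ w : Vec3, Torus.IsSmooth w → Torus.IsDivFree w → Torus.HasZeroMean w →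
              |Torus.nsGeneratorPairing 0 f v w| ≤ 2 * R * Real.sqrt (Torus.gradNormSq w))} ≤ 1 / 2 →
          c ≤ R * Real.sqrt (Torus.ensembleEnstrophy μ).toReal)
    (hDYN : ∀ (f : Vec3), f = gpForce → ∀ E : ℝ,
      ∃ c δ₀ : ℝ, 0 < c ∧ 0 < δ₀ ∧ ∀ μ : Measure H3, IsProbabilityMeasure μ →
        Integrable (fun v : H3 => ‖v‖ ^ 2) μ → Torus.ensembleEnergy μ ≤ E → Torus.ensembleEnstrophy μ < ⊤ →
        (∀ e₁ e₂ : ℝ≥0∞, e₁ < e₂ →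
          0 ≤ ∫ v in {v : H3 | e₁ ≤ ‖v‖ₑ ^ 2 ∧ ‖v‖ₑ ^ 2 < e₂}, Torus.pairing (v : L2) f ∂μ) →
        ∀ R : ℝ, 0 ≤ R → R ≤ δ₀ →
          (∀ Φ : Torus.CylindricalTest (Fin 3),
            Integrable (fun v : H3 => Torus.nsGeneratorPairing 0 f v (Φ.grad v)) μ ∧
              |∫ v, Torus.nsGeneratorPairing 0 f v (Φ.grad v) ∂μ| ≤
                R * Real.sqrt (∫ v, Torus.gradNormSq (Φ.grad v) ∂μ)) →
          1 / 2 < μ {v : H3 | ¬ (∀ w : Vec3, Torus.IsSmooth w → Torus.IsDivFree w → Torus.HasZeroMean w →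
              |Torus.nsGeneratorPairing 0 f v w| ≤ 2 * R * Real.sqrt (Torus.gradNormSq w))} →
          c ≤ R * Real.sqrt (Torus.ensembleEnstrophy μ).toReal)
    (f : Vec3) (hf : f = gpForce) (E : ℝ) :
    ∃ c δ₀ : ℝ, 0 < c ∧ 0 < δ₀ ∧ ∀ μ : Measure H3, IsProbabilityMeasure μ →
      Integrable (fun v : H3 => ‖v‖ ^ 2) μ → Torus.ensembleEnergy μ ≤ E → Torus.ensembleEnstrophy μ < ⊤ →
      (∀ e₁ e₂ : ℝ≥0∞, e₁ < e₂ →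
        0 ≤ ∫ v in {v : H3 | e₁ ≤ ‖v‖ₑ ^ 2 ∧ ‖v‖ₑ ^ 2 < e₂}, Torus.pairing (v : L2) f ∂μ) →
      ∀ R : ℝ, 0 ≤ R → R ≤ δ₀ →
        (∀ Φ : Torus.CylindricalTest (Fin 3),
          Integrable (fun v : H3 => Torus.nsGeneratorPairing 0 f v (Φ.grad v)) μ ∧
            |∫ v, Torus.nsGeneratorPairing 0 f v (Φ.grad v) ∂μ| ≤
              R * Real.sqrt (∫ v, Torus.gradNormSq (Φ.grad v) ∂μ)) →
        c ≤ R * Real.sqrt (Torus.ensembleEnstrophy μ).toReal := by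
  obtain ⟨c₁, δ₁, hc₁, hδ₁, hqs⟩ := hQS f hf (hSF f hf) E
  obtain ⟨c₂, δ₂, hc₂, hδ₂, hdyn⟩ := hDYN f hf E
  refine ⟨min c₁ c₂, min δ₁ δ₂, lt_min hc₁ hc₂, lt_min hδ₁ hδ₂, ?_⟩
  intro μ hμ hint hEμ hG hshell R hR0 hRδ hdef
  rcases le_or_gt (μ {v : H3 | ¬ (∀ w : Vec3, Torus.IsSmooth w → Torus.IsDivFree w → Torus.HasZeroMean w →
      |Torus.nsGeneratorPairing 0 f v w| ≤ 2 * R * Real.sqrt (Torus.gradNormSq w))}) (1 / 2) with hstat | hdynm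
  · -- static-dominated: anti-dilution (QS, fed by SF)
    calc min c₁ c₂ ≤ c₁ := min_le_left _ _
      _ ≤ R * Real.sqrt (Torus.ensembleEnstrophy μ).toReal :=
        hqs μ hμ hint hEμ hG R hR0 (hRδ.trans (min_le_left _ _)) hstat
  · -- dynamic-dominated: the open content (DYN)
    calc min c₁ c₂ ≤ c₂ := min_le_right _ _
      _ ≤ R * Real.sqrt (Torus.ensembleEnstrophy μ).toReal :=
        hdyn μ hμ hint hEμ hG hshell R hR0 (hRδ.trans (min_le_right _ _)) hdef hdynm

/-- **Statistical Lamb rigidity of `f_GP`** — the route declaration `EnsembleRigidity.GPStatisticalRigidity`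
(item stmt-AnomalousDissipation-15508) BY NAME, from the three stubs through the sorry-free composition
`staticDynamicBlock_of_pieces` (force pinned by `gpForce_eq`, `rfl`). -/
theorem GPStatisticalRigidity_of :
    Summit.AnomalousDissipation.AnomalousDissipation.Theses.EnsembleRigidity.GPStatisticalRigidity := by
  intro f hf E
  exact staticDynamicBlock_of_pieces stub_singleFieldRigidity stub_quasiStaticReduction stub_dynamicBranch f
    (hf.trans gpForce_eq.symm) E

end Summit.AnomalousDissipation.AnomalousDissipation.Cruxes.GPStatisticalRigidity.StaticDynamic

end
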